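import Summits.QuantumAdvantage.QuantumAdvantage.Theses.OddPrimeWalk
import Summits.QuantumAdvantage.AdviceFreeQNC0.WalkHardFShotsSqrt
import HarnessLib

/-!
# Route OddPrimeWalk, crux `ShotsSqrtOdd` (stmt-QuantumAdvantage-23022, rung R6): the `√n`-shots rung for every prime `p ≥ 5`

The item `ShotsSqrtOdd` — `∀ p ≥ 5 prime`: strategies of `𝔽_p`-degree `(log₂ n)^C` firing AT MOST `B` cuts on every input
(positions arbitrary and adaptive, potential support dense), with `B²·(log₂ n)^{2C+3} ≤ n`, win α's u-walk game `ringWinU` on at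
most `θ·2ⁿ` inputs, one `θ < 1` for all `C` — is the tree theorem
`Summit.QuantumAdvantage.AdviceFreeQNC0.walkHardFShotsSqrt (p) (hp3 : p ≠ 3)` (`AdviceFreeQNC0/WalkHardFShotsSqrt.lean`:
quiet-interval surgery, the cut-free fibre argument, the six class parities of the named residue realised by one
Srinivasan–Tripathi–Venkitesh seed family, and qn-prover g10's robust elimination `elimLevelSqrtF_robust`) at `p ≥ 5`;
the item's body and `WalkHardFShotsSqrt p` agree verbatim.
WHAT THIS IS NOT: the `√n`-dense residual `DenseResidualSqrtOdd` (crux, research) is open; separation NOT moved by this item alone.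
-/

set_option linter.dupNamespace false

namespace Summit.QuantumAdvantage.QuantumAdvantage.Theorems

/-- **Crux `ShotsSqrtOdd` — PROVED**: `∀ p ≥ 5 prime, WalkHardFShotsSqrt p` (one line over `AdviceFreeQNC0.walkHardFShotsSqrt`). -/
theorem oddPrimeWalk_shotsSqrtOdd : Summit.QuantumAdvantage.QuantumAdvantage.Theses.OddPrimeWalk.ShotsSqrtOdd :=
  fun p _ hp => Summit.QuantumAdvantage.AdviceFreeQNC0.walkHardFShotsSqrt p (by omega)

end Summit.QuantumAdvantage.QuantumAdvantage.Theorems
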